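import Summits.QuantumFields.YangMills.Theorems.BalabanUVNodesN07ShearDatumBCH
import Literature.MathematicalPhysics.QuantumFieldTheory.Balaban1983to89.Node00.ShearedAveragingRecordPureGauge
import Literature.MathematicalPhysics.QuantumFieldTheory.Balaban1983to89.Node00.Record11
import HarnessLib

/-!
# DAG node N07 [B11] — road R0′'s BCH row (r1) AT THE RECORD: the datum of the Landau copy `M^j(U₁)(c)` is the axial datum `M^j(U′)(c) = V″(c)` plus the coarse pure gauge
# `λ(c₋) − λ(c₊)` plus a quadratic remainder `‖N₂(c)‖ ≤ 8σ² + 20σv`, in the record's letters (`avOfRecord`, `SU(N) ⊂ M_N(ℂ)`, `MatrixLog.mlog`) — the record adapter of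
# dag-n07-w7's `…N07ShearDatumBCH` keyed on the coarse gauge `g := u↾T^{(j)}` ((r0′), covariance only) and on the intrinsic `S_j(U₁)` ((r0), under (1.29))

Cell `pub-ymgap` (HUMAN RULINGS D-0062 ∕ D-0088 ∕ D-0149), width seat `pub-ymgap-dag-n07-w6` g0 (second wave), 2026-08-28; lane owner dag-n07-e g20's word (cell bus 06:38Z, (D)):
«(r1) record adapter — YES, yours AFTER n07-w7's abstract `…N07ShearDatumBCH` lands: key it on `g := toMS u j` letters ((r0′); `h1`∕`S_j` optional via p609211) and take (r4)'s σ♮ as the supplier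
of `ℓ`».  `--kind proof --supports stmt-QuantumFields-20542 --as helper` (K1⁷; count-neutral).  THEOREMS ONLY.

THE PRINT.  [B11] = T. Bałaban, *The variational problem and background fields in renormalization group method for lattice gauge theories*, Commun. Math. Phys. **102** (1985) 277–309
`[Balaban1985Variational]`, (152)–(156) pp. 301–302 (the Landau copy `U₁ = U′^{u⁻¹}`, the datum `B = (1∕i) log V₁`, «Q_j(ηA) = B on Λ′_j»); [6] = [Balaban1985RegularSpaces] (1.29)–(1.31) pp. 80–81;
[3] = [Balaban1985Averaging] (11) p. 19 (covariance), (31) p. 22 (the two-factor BCH bound), (85)–(88) p. 31.  Plan g83 WORDS-2 (cell bus I.29399): road of record R0′ — «the axial→Landau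
shear carried as the COARSE PURE GAUGE `∂_cλ` … and absorbed EXACTLY at linear order by `H(∂_cλ) = ∂μ`», rows (r0) naming · (r1) BCH · (r2) shift · (r3) V-slot · (r4) shear size.

WHAT THIS FILE DOES (by-name composition; NOTHING of [B11]∕[6]∕[3] analysis asserted).
* §1 (every torus `P`, level `j`, `SU(N)`): `coe_gaugeAct_apply` (bookkeeping: the gauge-transformed bond variable as the three-factor product of matrices, the coarse factor read through
  NODE 00's unit embedding `ιSU`); ★ `norm_mlog_gaugeAct_sub_le` — dag-n07-w7's ★★ `norm_mlog_conj_shear_sub_le` read on a bond of `T^{(j)}`: for a gauge transformation `s` with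
  `‖s(c∓) − 1‖ ≤ σ ≤ 1∕80` and a configuration `W` with `‖W(c) − 1‖ ≤ v ≤ 1∕40`, `‖log W^s(c) − (log W(c) + (log s(c₋) − log s(c₊)))‖ ≤ 8σ² + 20σv`.
* §2 (r0′) «covariance only» (r13 `iter_gaugeAct` + dag-p07 `gaugeAct_inv_gaugeAct`): `iter_eq_gaugeAct_inv_toMS` (`M^j(U₁) = (M^j(U₁^u))^{(u↾T^{(j)})⁻¹}`, any averaging family, `j ≤ m + K`);
  AT THE RECORD ★★ `norm_mlog_iter_avOfRecord_sub_le_toMS` — with `g := u↾T^{(j)}`, `‖g(c∓) − 1‖ ≤ σ`, `‖M^j(U′)(c) − 1‖ ≤ v`: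
  `‖log M^j(U₁)(c) − (log M^j(U′)(c) + (log g(c₋)⁻¹ − log g(c₊)⁻¹))‖ ≤ 8σ² + 20σv` — NO axial gauge, NO normalisation needed.
* §3 (r0) «intrinsic» (this seat's p609211 `iter_avOfRecord_eq_gaugeAct_shearRIter`): ★★★ `norm_mlog_iter_avOfRecord_sub_le` — under the block axial gauges of `M^i(U′)`, `i < j`, and the
  (81)∕(1.29) normalisation at `c`'s ends, with `λ := log ∘ S_j(U₁)`, `‖S_j(U₁)(c∓) − 1‖ ≤ σ`, `‖M^j(U′)(c) − 1‖ ≤ v`: `‖log M^j(U₁)(c) − (log M^j(U′)(c) + (λ(c₋) − λ(c₊)))‖ ≤ 8σ² + 20σv`;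
  `…_data` (with the (150) constraint `M^j(U′)(c) = V″(c)` displayed); ★★ `exists_remainder_iter_avOfRecord` (the split `log M^j(U₁) = log V″ + (λ(c₋) − λ(c₊)) + N₂` with `‖N₂(c)‖ ≤ 8σ² + 20σv`
  on every bond of a set where the hypotheses hold — the letters the (164) budget line and dag-n07-w8's (r2) size line read).
* §4 (v1.1, A6) NON-VACUITY `norm_mlog_iter_avOfRecord_sub_le_one`: at `U₁ = 1`, `u = 1` every hypothesis of the intrinsic row holds with `σ = v = 0` and the remainder bound is `0`.
The shear size `σ` is DISPLAYED here; its supplier is row (r4) (dag-n07-e INTENT-43 `Node00/ShearedDatumCentred` + this seat's record instance, CLAIM-4), `v` is module 40's ∕ (151)'s.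

HONEST FRAMING (binding).  Count-neutral helper; Banach-algebra ∕ gauge bookkeeping over landed theorems (dag-n07-w7 p609976, this seat p608036 ∕ p609211, r13, dag-p07, node00-def `ιSU`); the axial
gauges, the (1.29) normalisation and both smallness letters are HYPOTHESES; the (46)∕(164) budget multiplication and the heart are NOT here; BRIDGE-92-B stays GAP-STATED until (r1)–(r4) + records
land; tokens ∕ stub 1 ∕ K0⁷ ∕ K1⁷ NOT closed; N07 NOT discharged (typed 28∕28 · discharged 5∕27 unmoved); no summit statement is proved by this seat; one finite `T⁴` programme at fixed `ε`, Bałaban AS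
PRINTED — the route closes the conditional finite-𝕋⁴ rung `BalabanLadder.UV` only; NOT continuum ∕ ℝ⁴ ∕ OS ∕ mass gap ∕ Clay.  No `sorry`, no `def`, no `instance`, no `notation`.
-/

noncomputable section

namespace Summit.QuantumFields.YangMills.BalabanUVNodes.N07ShearDatumBCHAtRecord

open scoped Matrix.Norms.L2Operator
open Literature.MathematicalPhysics.QuantumFieldTheory.Balaban1983to89
open Literature.MathematicalPhysics.QuantumFieldTheory.Balaban1983to89.Node00
open MatrixLog (mlog)
open GaugeField (gaugeAct)
open B16Sect1Backgrounds (toMS iter_gaugeAct)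
open B12RTGaugeInvariance254 (invTransf gaugeAct_inv_gaugeAct)
open ExpMeanLog (expMeanLogSU)
open Summit.QuantumFields.YangMills.Theorems.N07ShearDatumBCH (norm_mlog_conj_shear_sub_le)

/-! ## §1  One bond of a torus: the gauge-transformed bond variable in logarithmic coordinates -/

section Torus

variable {P : Params} {j : ℕ} (N : ℕ) [NeZero N]

/-- Bookkeeping: `W^s(c) = s(c₋)·W(c)·s(c₊)⁻¹` as matrices, the coarse factors read through NODE 00's unit embedding `ιSU : SU(N) →* M_N(ℂ)ˣ` (`coe_ιSU`, `map_inv`).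
[cite: Balaban1985Averaging, (8) p.18] -/
theorem coe_gaugeAct_apply (s : GaugeTransf P j (SU N)) (W : GaugeField P j (SU N)) (c : PBond P j) :
    ((gaugeAct s W c : SU N) : MatA N) =
      ((ιSU N (s c.src) : (MatA N)ˣ) : MatA N) * ((W c : SU N) : MatA N) * (((ιSU N (s c.tgt))⁻¹ : (MatA N)ˣ) : MatA N) := by
  rw [← map_inv]
  rfl

/-- ★ **dag-n07-w7's BCH row on a bond of `T^{(j)}`**: for a gauge transformation `s` of `T^{(j)}` with `‖s(c₋) − 1‖, ‖s(c₊) − 1‖ ≤ σ ≤ 1∕80` and a configuration `W` with `‖W(c) − 1‖ ≤ v ≤ 1∕40`,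
the logarithm of the transformed bond variable is «`log W(c)` + the coarse pure gauge `log s(c₋) − log s(c₊)`» up to `8σ² + 20σv` (`N07ShearDatumBCH.norm_mlog_conj_shear_sub_le` at `Sm := s(c₋)`,
`Sp := s(c₊)`, `V := W(c)`). [cite: Balaban1985Averaging, (31) p.22; Balaban1985RegularSpaces, (1.31) p.81] -/
theorem norm_mlog_gaugeAct_sub_le (s : GaugeTransf P j (SU N)) (W : GaugeField P j (SU N)) {σ v : ℝ} (hσ : σ ≤ 1 / 80) (hv : v ≤ 1 / 40)
    (c : PBond P j) (hs₁ : ‖((s c.src : SU N) : MatA N) - 1‖ ≤ σ) (hs₂ : ‖((s c.tgt : SU N) : MatA N) - 1‖ ≤ σ)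
    (hW : ‖((W c : SU N) : MatA N) - 1‖ ≤ v) :
    ‖mlog ((gaugeAct s W c : SU N) : MatA N) -
        (mlog ((W c : SU N) : MatA N) + (mlog ((s c.src : SU N) : MatA N) - mlog ((s c.tgt : SU N) : MatA N)))‖ ≤ 8 * σ ^ 2 + 20 * σ * v := by
  rw [coe_gaugeAct_apply]
  exact norm_mlog_conj_shear_sub_le (ιSU N (s c.src)) (ιSU N (s c.tgt)) _ hσ hv hs₁ hs₂ hW

end Torus

/-! ## §2  (r0′) «covariance only»: `M^j(U₁) = (M^j(U′))^{(u↾T^{(j)})⁻¹}` and its logarithmic split at the record -/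

section Covariance

variable {P : Params} {G : Type*} [GaugeGroup G]

/-- **(r0′), covariance only** ([3] (11) iterated, r13's `iter_gaugeAct`, read backwards with dag-p07's `gaugeAct_inv_gaugeAct`): for `U′ = U₁^u` and `j ≤ m + K`,
`M^j(U₁) = (M^j(U′))^{g⁻¹}` with `g := u↾T^{(j)}` — the plain `j`-fold average of the Landau copy is the axial datum re-gauged by the INVERSE centre values of `u`; no axial gauge and no
normalisation are needed for this sentence. [cite: Balaban1985Averaging, (11) p.19; Balaban1985Variational, (152)–(154) pp.301–302] -/
theorem iter_eq_gaugeAct_inv_toMS (av : ∀ i, Averaging P i G) (u : GaugeTransf P 0 G) (U₁ : GaugeField P 0 G) {j : ℕ} (hj : j ≤ P.m + P.K) :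
    Averaging.iter av j U₁ = gaugeAct (invTransf (toMS u j)) (Averaging.iter av j (gaugeAct u U₁)) := by
  rw [iter_gaugeAct av u U₁ j hj, gaugeAct_inv_gaugeAct]

variable (F : T4Continuum.T4Family) (N : ℕ) [NeZero N]

/-- ★★ **ROW (r1) AT THE RECORD, keyed on `g := u↾T^{(j)}` ((r0′))**: for the averaging of record and ANY `u`, `U₁` with `U′ := U₁^u`, if `‖g(c₋) − 1‖, ‖g(c₊) − 1‖ ≤ σ ≤ 1∕80` (the shear size — row
(r4)'s letter; note `‖g⁻¹ − 1‖ = ‖g − 1‖` for unitaries) and `‖M^j(U′)(c) − 1‖ ≤ v ≤ 1∕40` (the axial datum's size, (151)), then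
`‖log M^j(U₁)(c) − (log M^j(U′)(c) + (log g(c₋)⁻¹ − log g(c₊)⁻¹))‖ ≤ 8σ² + 20σv`. [cite: Balaban1985Variational, (152)–(156) pp.301–302; Balaban1985Averaging, (31) p.22] -/
theorem norm_mlog_iter_avOfRecord_sub_le_toMS (K : ℕ) (u : GaugeTransf (F.P K) 0 (SU N)) (U₁ : GaugeField (F.P K) 0 (SU N)) {j : ℕ}
    (hj : j ≤ (F.P K).m + (F.P K).K) {σ v : ℝ} (hσ : σ ≤ 1 / 80) (hv : v ≤ 1 / 40) (c : PBond (F.P K) j)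
    (hg₁ : ‖(((toMS u j c.src)⁻¹ : SU N) : MatA N) - 1‖ ≤ σ) (hg₂ : ‖(((toMS u j c.tgt)⁻¹ : SU N) : MatA N) - 1‖ ≤ σ)
    (hW : ‖((Averaging.iter (avOfRecord F N K) j (gaugeAct u U₁) c : SU N) : MatA N) - 1‖ ≤ v) :
    ‖mlog ((Averaging.iter (avOfRecord F N K) j U₁ c : SU N) : MatA N) -
        (mlog ((Averaging.iter (avOfRecord F N K) j (gaugeAct u U₁) c : SU N) : MatA N) +
          (mlog (((toMS u j c.src)⁻¹ : SU N) : MatA N) - mlog (((toMS u j c.tgt)⁻¹ : SU N) : MatA N)))‖ ≤ 8 * σ ^ 2 + 20 * σ * v := by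
  have h := norm_mlog_gaugeAct_sub_le N (invTransf (toMS u j)) (Averaging.iter (avOfRecord F N K) j (gaugeAct u U₁)) hσ hv c hg₁ hg₂ hW
  rwa [← iter_eq_gaugeAct_inv_toMS (avOfRecord F N K) u U₁ hj] at h

end Covariance

/-! ## §3  (r0) «intrinsic»: the split keyed on `S_j(U₁)` under the axial gauges and the (1.29) normalisation -/

section Intrinsic

variable (F : T4Continuum.T4Family) (N : ℕ) [NeZero N]

/-- ★★★ **ROW (r1) AT THE RECORD, keyed on the INTRINSIC coarse gauge `S_j(U₁)`** (p609211's (r0) `iter_avOfRecord_eq_gaugeAct_shearRIter`, then §1): under the block axial gauges of `M^i(U′)`, `i < j ≤ m + K`,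
`U′ = U₁^u`, for the contour datum of record, and the (81)∕(1.29) normalisation `R̄ʲu = 1` at both ends of `c`; with `λ := log ∘ S_j(U₁)` and the letters `‖S_j(U₁)(c∓) − 1‖ ≤ σ ≤ 1∕80`,
`‖M^j(U′)(c) − 1‖ ≤ v ≤ 1∕40`:  `‖log M^j(U₁)(c) − (log M^j(U′)(c) + (λ(c₋) − λ(c₊)))‖ ≤ 8σ² + 20σv` — the sheared datum is the axial datum plus a coarse pure gauge plus a QUADRATIC remainder.
[cite: Balaban1985Variational, (152)–(156) pp.301–302; Balaban1985Averaging, (85)–(88) p.31, (31) p.22] -/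
theorem norm_mlog_iter_avOfRecord_sub_le (K : ℕ) {u : GaugeTransf (F.P K) 0 (SU N)} {U₁ : GaugeField (F.P K) 0 (SU N)} {j : ℕ}
    (hj : j ≤ (F.P K).m + (F.P K).K)
    (hax : ∀ i < j, AxialGauge (contourOfRecord F N K i) (Averaging.iter (avOfRecord F N K) i (gaugeAct u U₁)))
    {c : PBond (F.P K) j} (hsrc : gaugeAvgIter (loopAvgBlockOp expMeanLogSU) u j c.src = 1)
    (htgt : gaugeAvgIter (loopAvgBlockOp expMeanLogSU) u j c.tgt = 1) {σ v : ℝ} (hσ : σ ≤ 1 / 80) (hv : v ≤ 1 / 40)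
    (hS₁ : ‖((shearRIter (avOfRecord F N K) (contourOfRecord F N K) (loopAvgBlockOp expMeanLogSU) U₁ j c.src : SU N) : MatA N) - 1‖ ≤ σ)
    (hS₂ : ‖((shearRIter (avOfRecord F N K) (contourOfRecord F N K) (loopAvgBlockOp expMeanLogSU) U₁ j c.tgt : SU N) : MatA N) - 1‖ ≤ σ)
    (hW : ‖((Averaging.iter (avOfRecord F N K) j (gaugeAct u U₁) c : SU N) : MatA N) - 1‖ ≤ v) :
    ‖mlog ((Averaging.iter (avOfRecord F N K) j U₁ c : SU N) : MatA N) -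
        (mlog ((Averaging.iter (avOfRecord F N K) j (gaugeAct u U₁) c : SU N) : MatA N) +
          (mlog ((shearRIter (avOfRecord F N K) (contourOfRecord F N K) (loopAvgBlockOp expMeanLogSU) U₁ j c.src : SU N) : MatA N) -
            mlog ((shearRIter (avOfRecord F N K) (contourOfRecord F N K) (loopAvgBlockOp expMeanLogSU) U₁ j c.tgt : SU N) : MatA N)))‖ ≤
      8 * σ ^ 2 + 20 * σ * v := by
  rw [iter_avOfRecord_eq_gaugeAct_shearRIter F N K hj hax hsrc htgt]
  exact norm_mlog_gaugeAct_sub_le N _ _ hσ hv c hS₁ hS₂ hW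

/-- The same with the (150) constraint displayed: `M^j(U′)(c) = V″(c)` ⇒ `‖log M^j(U₁)(c) − (log V″(c) + (λ(c₋) − λ(c₊)))‖ ≤ 8σ² + 20σv`.
[cite: Balaban1985Variational, (150) p.301, (154)–(156) p.302] -/
theorem norm_mlog_iter_avOfRecord_sub_le_data (K : ℕ) {u : GaugeTransf (F.P K) 0 (SU N)} {U₁ : GaugeField (F.P K) 0 (SU N)} {j : ℕ}
    (hj : j ≤ (F.P K).m + (F.P K).K)
    (hax : ∀ i < j, AxialGauge (contourOfRecord F N K i) (Averaging.iter (avOfRecord F N K) i (gaugeAct u U₁)))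
    {V : GaugeField (F.P K) j (SU N)} {c : PBond (F.P K) j} (hVc : Averaging.iter (avOfRecord F N K) j (gaugeAct u U₁) c = V c)
    (hsrc : gaugeAvgIter (loopAvgBlockOp expMeanLogSU) u j c.src = 1) (htgt : gaugeAvgIter (loopAvgBlockOp expMeanLogSU) u j c.tgt = 1)
    {σ v : ℝ} (hσ : σ ≤ 1 / 80) (hv : v ≤ 1 / 40)
    (hS₁ : ‖((shearRIter (avOfRecord F N K) (contourOfRecord F N K) (loopAvgBlockOp expMeanLogSU) U₁ j c.src : SU N) : MatA N) - 1‖ ≤ σ)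
    (hS₂ : ‖((shearRIter (avOfRecord F N K) (contourOfRecord F N K) (loopAvgBlockOp expMeanLogSU) U₁ j c.tgt : SU N) : MatA N) - 1‖ ≤ σ)
    (hV : ‖((V c : SU N) : MatA N) - 1‖ ≤ v) :
    ‖mlog ((Averaging.iter (avOfRecord F N K) j U₁ c : SU N) : MatA N) -
        (mlog ((V c : SU N) : MatA N) +
          (mlog ((shearRIter (avOfRecord F N K) (contourOfRecord F N K) (loopAvgBlockOp expMeanLogSU) U₁ j c.src : SU N) : MatA N) -
            mlog ((shearRIter (avOfRecord F N K) (contourOfRecord F N K) (loopAvgBlockOp expMeanLogSU) U₁ j c.tgt : SU N) : MatA N)))‖ ≤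
      8 * σ ^ 2 + 20 * σ * v := by
  have h := norm_mlog_iter_avOfRecord_sub_le F N K hj hax hsrc htgt hσ hv hS₁ hS₂ (by rw [hVc]; exact hV)
  rwa [hVc] at h

/-- ★★ **THE SPLIT WITH A NAMED REMAINDER on a set of bonds**: if on every bond `c ∈ B` of `T^{(j)}` the normalisation holds at both ends, `‖S_j(U₁)(c∓) − 1‖ ≤ σ` and `M^j(U′)(c) = V″(c)` with
`‖V″(c) − 1‖ ≤ v`, then there is `N₂ : bonds → M_N(ℂ)` with `log M^j(U₁)(c) = log V″(c) + (λ(c₋) − λ(c₊)) + N₂(c)` and `‖N₂(c)‖ ≤ 8σ² + 20σv` for all `c ∈ B` — the letters read by the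
(164) budget line (`|HB| ≤ B₀|B|`, [B11] (46)) and by dag-n07-w8's (r2) size line. [cite: Balaban1985Variational, (154)–(156) p.302, (164) p.303] -/
theorem exists_remainder_iter_avOfRecord (K : ℕ) {u : GaugeTransf (F.P K) 0 (SU N)} {U₁ : GaugeField (F.P K) 0 (SU N)} {j : ℕ}
    (hj : j ≤ (F.P K).m + (F.P K).K)
    (hax : ∀ i < j, AxialGauge (contourOfRecord F N K i) (Averaging.iter (avOfRecord F N K) i (gaugeAct u U₁)))
    {V : GaugeField (F.P K) j (SU N)} {σ v : ℝ} (hσ : σ ≤ 1 / 80) (hv : v ≤ 1 / 40) (B : Set (PBond (F.P K) j))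
    (hnorm : ∀ c ∈ B, gaugeAvgIter (loopAvgBlockOp expMeanLogSU) u j c.src = 1 ∧ gaugeAvgIter (loopAvgBlockOp expMeanLogSU) u j c.tgt = 1)
    (hS : ∀ c ∈ B, ‖((shearRIter (avOfRecord F N K) (contourOfRecord F N K) (loopAvgBlockOp expMeanLogSU) U₁ j c.src : SU N) : MatA N) - 1‖ ≤ σ ∧
      ‖((shearRIter (avOfRecord F N K) (contourOfRecord F N K) (loopAvgBlockOp expMeanLogSU) U₁ j c.tgt : SU N) : MatA N) - 1‖ ≤ σ)
    (hVeq : ∀ c ∈ B, Averaging.iter (avOfRecord F N K) j (gaugeAct u U₁) c = V c) (hV : ∀ c ∈ B, ‖((V c : SU N) : MatA N) - 1‖ ≤ v) :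
    ∃ N₂ : PBond (F.P K) j → MatA N, ∀ c ∈ B,
      mlog ((Averaging.iter (avOfRecord F N K) j U₁ c : SU N) : MatA N) =
          mlog ((V c : SU N) : MatA N) +
            (mlog ((shearRIter (avOfRecord F N K) (contourOfRecord F N K) (loopAvgBlockOp expMeanLogSU) U₁ j c.src : SU N) : MatA N) -
              mlog ((shearRIter (avOfRecord F N K) (contourOfRecord F N K) (loopAvgBlockOp expMeanLogSU) U₁ j c.tgt : SU N) : MatA N)) + N₂ c ∧
        ‖N₂ c‖ ≤ 8 * σ ^ 2 + 20 * σ * v := by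
  refine ⟨fun c => mlog ((Averaging.iter (avOfRecord F N K) j U₁ c : SU N) : MatA N) -
      (mlog ((V c : SU N) : MatA N) +
        (mlog ((shearRIter (avOfRecord F N K) (contourOfRecord F N K) (loopAvgBlockOp expMeanLogSU) U₁ j c.src : SU N) : MatA N) -
          mlog ((shearRIter (avOfRecord F N K) (contourOfRecord F N K) (loopAvgBlockOp expMeanLogSU) U₁ j c.tgt : SU N) : MatA N))),
    fun c hc => ⟨(add_sub_cancel _ _).symm, ?_⟩⟩
  exact norm_mlog_iter_avOfRecord_sub_le_data F N K hj hax (hVeq c hc) (hnorm c hc).1 (hnorm c hc).2 hσ hv (hS c hc).1 (hS c hc).2 (hV c hc)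

end Intrinsic

/-! ## §4  (v1.1, A6) Non-vacuity: at the unit configuration every hypothesis of the intrinsic row holds with `σ = v = 0`, and the remainder bound is `0` -/

section NonVacuity

variable (F : T4Continuum.T4Family) (N : ℕ) [NeZero N]

open B16Sect1Backgrounds (toMS)

/-- ★ **A6 NON-VACUITY of row (r1) at the record**: at `U₁ = 1`, `u = 1`, for every `j ≤ m + K` and every bond `c` of `T^{(j)}`, ALL hypotheses of `norm_mlog_iter_avOfRecord_sub_le` hold — the axial
gauges of `M^i(1)` (p608036 `axialGauge_iter_avOfRecord_one`), the (1.29) normalisation `R̄ʲ1 = 1` (`gaugeAvgIter_loopAvgBlockOp_one`), the shear letters with `σ = 0` (`S_j(1) = 1`, p608036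
`shearRIter_avOfRecord_one`) and the datum letter with `v = 0` (`M^j(1) = 1`) — and the conclusion reads with remainder bound `8·0² + 20·0·0 = 0`: the hypothesis set is inhabited and tight
at the unit configuration. [cite: Balaban1985Variational, (152)–(156) pp.301–302] -/
theorem norm_mlog_iter_avOfRecord_sub_le_one (K : ℕ) {j : ℕ} (hj : j ≤ (F.P K).m + (F.P K).K) (c : PBond (F.P K) j) :
    ‖mlog ((Averaging.iter (avOfRecord F N K) j (1 : GaugeField (F.P K) 0 (SU N)) c : SU N) : MatA N) -
        (mlog ((Averaging.iter (avOfRecord F N K) j (gaugeAct (fun _ => (1 : SU N)) (1 : GaugeField (F.P K) 0 (SU N))) c : SU N) : MatA N) +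
          (mlog ((shearRIter (avOfRecord F N K) (contourOfRecord F N K) (loopAvgBlockOp expMeanLogSU) (1 : GaugeField (F.P K) 0 (SU N)) j c.src : SU N) : MatA N) -
            mlog ((shearRIter (avOfRecord F N K) (contourOfRecord F N K) (loopAvgBlockOp expMeanLogSU) (1 : GaugeField (F.P K) 0 (SU N)) j c.tgt : SU N) : MatA N)))‖ ≤
      8 * (0 : ℝ) ^ 2 + 20 * 0 * 0 := by
  have h1 := gaugeAvgIter_loopAvgBlockOp_one (P := F.P K) expMeanLogSU (expMeanLogSU_E_one' N) j
  have hS := shearRIter_avOfRecord_one F N K j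
  refine norm_mlog_iter_avOfRecord_sub_le F N K hj (fun i _ => axialGauge_iter_avOfRecord_one F N K i) (by rw [h1]) (by rw [h1])
    (by norm_num) (by norm_num) ?_ ?_ ?_
  · rw [hS]; simp
  · rw [hS]; simp
  · rw [B12RTGaugeInvariance254.gaugeAct_one', B15Claim189UnitTestAtRecord.iter_avOfRecord_one F N K j]
    show ‖((((1 : GaugeField (F.P K) j (SU N)) c : SU N)) : MatA N) - 1‖ ≤ 0
    simp [show ((1 : GaugeField (F.P K) j (SU N)) c : SU N) = 1 from rfl]

end NonVacuity

end Summit.QuantumFields.YangMills.BalabanUVNodes.N07ShearDatumBCHAtRecord
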